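import Literature.AlgebraicGeometry.HodgeTheory.CMHodgeGroupDualBases
import HarnessLib

/-!
# Adapted `ψ_ℂ`-dual bases of `H¹ ⊗ ℂ = ⊕_σ H¹_σ` for a commutative endomorphism structure `E = ℚ[φ]` with UNEQUAL multiplicities: letters indexed by ONE alphabet `Fin N` with a block map (Deligne LNM 900 §4; Moonen–Zarhin 1999 §1, (2.3); the BLOCKED form of `CMTheta.exists_adaptedDualBasis`)

Family `hodge`, layer `Literature/AlgebraicGeometry/HodgeTheory`, namespace `Literature.AlgebraicGeometry.Motives.HodgeStructure`.
THEOREMS ONLY: no definition, no named fact, no `sorry` (D-0026). Written for the cell `pub-hodgeav-hg6` (req-37 (A) Q2b,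
TABLE X rows 17 ∕ 22), seat eng-2 g7, brick «B5a-P» = R17-S part S2 (lead g4 2026-08-29T07:53:39Z GO). HONEST FRAMING:
HC ∕ HC_AV (stmt-1333) ∕ HC_CM (stmt-3052) ∕ H2 are NOT proved and do not occur; this file is linear algebra on a
polarized Hodge structure of weight `1`.

WHAT. The tree's `CMTheta.exists_adaptedDualBasis` (`CMHodgeGroupDualBases`) produces, for an effective polarized Hodge
structure `H` of weight `1` with `End_Hdg(V) = ℚ[φ]` (`φ` with eigenvalue colours `μ : ι → ℂ`, injective, no `μ k'`
conjugate to a `μ k`, the `2|ι|` eigenspaces spanning `V_ℂ`), adapted `ψ_ℂ`-dual letters indexed by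
`(ι × Fin 2) × Fin n₀` — which requires EQUAL multiplicities `dim W_{μ k} = n₀` for all colours `k` (`hrank`). For the
PRODUCT rows of TABLE X (`A ∼ Y₅ × E_K`, `End⁰(A) = K × K`, blocks of sizes `5` and `1` on the Weil space) the
multiplicities differ. **`CMTheta.exists_blockedAdaptedDualBasis`** is the same construction WITHOUT `hrank`: the letters
are indexed by ONE alphabet, `cb (t, ℓ)`, `t : Fin 2` the type and `ℓ : Fin N` (`N = dim_ℂ (⊕_k W_{μ k})`), and the colour
of a letter is recorded by a BLOCK MAP `blk : Fin N → ι`: `cb (0, ℓ) ∈ W_{μ (blk ℓ)}`, `cb (1, ℓ) ∈ W_{conj μ (blk ℓ)}`,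
letters of kind `κ ℓ = 0` have types `(1,0) ∕ (0,1)`, of kind `1` types `(0,1) ∕ (1,0)`, and the pairing table is
`ψ_ℂ(cb (0,i), cb (1,j)) = δ_{ij}`, `ψ_ℂ(cb (t,i), cb (t,j)) = 0`. This is exactly the letter format of the one-colour
bricks (`UnitaryTheta.exists_adaptedDualBasis`, B5a `WeilTypeSixfoldHodgeGroupSUOfLie`) plus the block map consumed by the
block-diagonal invariant theory (`ClassicalInvariants/MixedTensorLieInvariantsSLBlockDiagonal`). Proof = the tree's proof
(credited: per-colour bases of `W_{μ k} ∩ V^{1,0}`, `W_{μ k} ∩ V^{0,1}` and their `ψ_ℂ`-duals by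
`QuarticTheta.pairing_bijective`, orthogonality of non-conjugate eigenspaces `CMTheta.form_eq_zero_of_ne` — the Rosati
involution is complex conjugation on `ℚ[φ]` — independence by the pairing table, spanning by `htop` and the
`Θ`-grading), with the letters collected in the sigma type `Σ k, (Fin (a k) ⊕ Fin (b k))` and enumerated by `Fin N`.

## References
* [Deligne1982HodgeCycles] P. Deligne, LNM 900 (1982), §4 (p. 30).
* [MoonenZarhin1999LowDim] B. Moonen, Yu. Zarhin, Math. Ann. 315 (1999), §1 and §2 (2.3).
* [MumfordAV1970] D. Mumford, *Abelian Varieties* (1970), §21 (the Rosati involution of a CM field).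
* [Milne1999LefschetzClasses] J. S. Milne, Duke Math. J. 96 (1999), §2 p. 651.
* [Gordon1997] B. B. Gordon, arXiv:alg-geom/9709030, §6 (proof of Thm. 6.3.3, p. 19).
-/

noncomputable section

open scoped TensorProduct
open Module

namespace Literature.AlgebraicGeometry.Motives

namespace HodgeStructure

section CMBlockedDualBases

universe u

variable {V : Type u} [AddCommGroup V] [Module ℚ V] {n : ℤ}

/-- The two elements of `Fin 2`. [folklore] -/
private theorem CMTheta.fin2_cases' (r : Fin 2) : r = 0 ∨ r = 1 := by
  fin_cases r <;> simp

/-- **Blocked adapted `ψ_ℂ`-dual bases for `E = ℚ[φ] ⊆ End_Hdg(V)` of any degree and ANY multiplicities.** Data: `H`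
effective polarized of weight `1`; `φ ∈ End_Hdg(V)` with `End_Hdg(V) = Σ_{k<m} ℚφ^k`; colours `μ : ι → ℂ` (one eigenvalue of
`φ_ℂ` per pair of conjugate places), `μ` injective and no `μ k'` conjugate to a `μ k`; `htop`: the `2|ι|` eigenspaces
`W_{μ k}`, `W_{conj μ k}` span `V_ℂ`. Then there are `N`, a basis `cb (t, ℓ)` (`t : Fin 2`, `ℓ : Fin N`) of `V_ℂ`, kinds
`κ : Fin N → Fin 2` and a BLOCK MAP `blk : Fin N → ι` with `cb (0, ℓ) ∈ W_{μ (blk ℓ)}`, `cb (1, ℓ) ∈ W_{conj μ (blk ℓ)}`,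
`cb (0,ℓ) ∈ V^{1,0}, cb (1,ℓ) ∈ V^{0,1}` for `κ ℓ = 0` and the opposite types for `κ ℓ = 1`,
`ψ_ℂ(cb (0,i), cb (1,j)) = δ_{ij}` and `ψ_ℂ = 0` on two letters of the same type. (The tree's
`CMTheta.exists_adaptedDualBasis` without the equal-multiplicity hypothesis `hrank`; same construction, letters enumerated
by one alphabet.) [cite: Deligne1982HodgeCycles, §4 (p. 30)] [cite: MoonenZarhin1999LowDim, §1 and §2 (2.3)]
[cite: Milne1999LefschetzClasses, §2 p. 651] [cite: Gordon1997, §6 (proof of Thm. 6.3.3, p. 19)] -/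
theorem CMTheta.exists_blockedAdaptedDualBasis [Module.Finite ℚ V] [HodgeTensorFacts.{u, u}] {ι : Type} [Fintype ι]
    [DecidableEq ι] (H : HodgeStructure V n) (hn : n = 1) (heff : H.IsEffective) (ψ : H.Polarization)
    {φ : Module.End ℚ V} (hφE : φ ∈ H.endAlg) {m : ℕ}
    (hE : ∀ a ∈ H.endAlg, ∃ q : Fin m → ℚ, a = ∑ k, q k • φ ^ (k : ℕ)) (μ : ι → ℂ)
    (hinj : Function.Injective μ) (hdist : ∀ k k', μ k' ≠ starRingEnd ℂ (μ k))
    (htop : (⨆ kt : ι × Fin 2, Module.End.eigenspace (φ.baseChange ℂ)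
      (if kt.2 = 0 then μ kt.1 else starRingEnd ℂ (μ kt.1))) = ⊤) :
    ∃ (N : ℕ) (cb : Module.Basis (Fin 2 × Fin N) ℂ (ℂ ⊗[ℚ] V)) (κ : Fin N → Fin 2) (blk : Fin N → ι),
      (∀ ℓ, cb (0, ℓ) ∈ Module.End.eigenspace (φ.baseChange ℂ) (μ (blk ℓ))) ∧
      (∀ ℓ, cb (1, ℓ) ∈ Module.End.eigenspace (φ.baseChange ℂ) (starRingEnd ℂ (μ (blk ℓ)))) ∧
      (∀ ℓ, κ ℓ = 0 → cb (0, ℓ) ∈ H.piece 1 0 ∧ cb (1, ℓ) ∈ H.piece 0 1) ∧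
      (∀ ℓ, κ ℓ = 1 → cb (0, ℓ) ∈ H.piece 0 1 ∧ cb (1, ℓ) ∈ H.piece 1 0) ∧
      (∀ i j, ψ.form.baseChange ℂ (cb (0, i)) (cb (1, j)) = if i = j then 1 else 0) ∧
      (∀ (t : Fin 2) i j, ψ.form.baseChange ℂ (cb (t, i)) (cb (t, j)) = 0) := by
  classical
  -- (the construction below is that of `CMTheta.exists_adaptedDualBasis`, letters collected in a sigma type)
  -- orthogonality of non-conjugate eigenspaces (`E = ℚ[φ]`)
  have hperp : ∀ {a b : ℂ}, a ≠ starRingEnd ℂ b → ∀ {x y : ℂ ⊗[ℚ] V},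
      x ∈ Module.End.eigenspace (φ.baseChange ℂ) a → y ∈ Module.End.eigenspace (φ.baseChange ℂ) b →
      ψ.form.baseChange ℂ x y = 0 := fun hab _ _ hx hy =>
    CMTheta.form_eq_zero_of_ne H hn heff ψ hφE hE hab hx hy
  subst hn
  obtain ⟨Θ, hΘ⟩ := exists_hodgeTheta H
  obtain ⟨hP, hQ, hΘ10, hΘ01, -⟩ := UnitaryTheta.theta_facts H rfl heff hΘ
  set φC := φ.baseChange ℂ with hφC
  set ψC := ψ.form.baseChange ℂ with hψC
  have hΘφ : Θ * φC = φC * Θ :=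
    commute_baseChange_of_mem_hodgeLieC H (H.mem_hodgeLieC_of_forall_piece hΘ) ⟨φ, hφE⟩
  have hΘW : ∀ c, ∀ w ∈ Module.End.eigenspace φC c, Θ w ∈ Module.End.eigenspace φC c := fun c w hw =>
    UnitaryTheta.apply_mem_eigenspace_of_commute hΘφ hw
  have h1100 : ∀ x ∈ H.piece 1 0, ∀ y ∈ H.piece 1 0, ψC x y = 0 := fun x hx y hy =>
    ψ.form_piece_piece (p := 1) (p' := 1) (by norm_num) (by simpa using hx) (by simpa using hy)
  have h0101 : ∀ x ∈ H.piece 0 1, ∀ y ∈ H.piece 0 1, ψC x y = 0 := fun x hx y hy =>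
    ψ.form_piece_piece (p := 0) (p' := 0) (by norm_num) (by simpa using hx) (by simpa using hy)
  -- the graded pieces of each colour and their bases
  set W₁ : ι → Submodule ℂ (ℂ ⊗[ℚ] V) := fun k => Module.End.eigenspace φC (μ k) ⊓ H.piece 1 0 with hW₁def
  set L : ι → Submodule ℂ (ℂ ⊗[ℚ] V) := fun k => Module.End.eigenspace φC (μ k) ⊓ H.piece 0 1 with hLdef
  set W₁' : ι → Submodule ℂ (ℂ ⊗[ℚ] V) := fun k =>
    Module.End.eigenspace φC (starRingEnd ℂ (μ k)) ⊓ H.piece 0 1 with hW₁'def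
  set L' : ι → Submodule ℂ (ℂ ⊗[ℚ] V) := fun k =>
    Module.End.eigenspace φC (starRingEnd ℂ (μ k)) ⊓ H.piece 1 0 with hL'def
  set a : ι → ℕ := fun k => Module.finrank ℂ ↥(W₁ k) with hadef
  set b : ι → ℕ := fun k => Module.finrank ℂ ↥(L k) with hbdef
  set b₁ : ∀ k, Module.Basis (Fin (a k)) ℂ ↥(W₁ k) := fun k => Module.finBasis ℂ ↥(W₁ k) with hb₁def
  set b₂ : ∀ k, Module.Basis (Fin (b k)) ℂ ↥(L k) := fun k => Module.finBasis ℂ ↥(L k) with hb₂def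
  set Φ₁ : ∀ k, ↥(W₁' k) ≃ₗ[ℂ] Module.Dual ℂ ↥(W₁ k) := fun k =>
    LinearEquiv.ofBijective _ (QuarticTheta.pairing_bijective H rfl ψ φ (μ k) 1 0 (by norm_num)) with hΦ₁def
  set Φ₂ : ∀ k, ↥(L' k) ≃ₗ[ℂ] Module.Dual ℂ ↥(L k) := fun k =>
    LinearEquiv.ofBijective _ (QuarticTheta.pairing_bijective H rfl ψ φ (μ k) 0 1 (by norm_num)) with hΦ₂def
  have hΦ₁ : ∀ k (y' : ↥(W₁' k)) (x : ↥(W₁ k)), Φ₁ k y' x = ψC x y' := fun k y' x => by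
    rw [hΦ₁def, LinearEquiv.ofBijective_apply, LinearMap.flip_apply, LinearMap.domRestrict₁₂_apply]
  have hΦ₂ : ∀ k (y' : ↥(L' k)) (x : ↥(L k)), Φ₂ k y' x = ψC x y' := fun k y' x => by
    rw [hΦ₂def, LinearEquiv.ofBijective_apply, LinearMap.flip_apply, LinearMap.domRestrict₁₂_apply]
  set fb₁ : ∀ k, Module.Basis (Fin (a k)) ℂ ↥(W₁' k) := fun k => (b₁ k).dualBasis.map (Φ₁ k).symm with hfb₁def
  set fb₂ : ∀ k, Module.Basis (Fin (b k)) ℂ ↥(L' k) := fun k => (b₂ k).dualBasis.map (Φ₂ k).symm with hfb₂def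
  have hfb₁ : ∀ k i (x : ↥(W₁ k)), ψC x (fb₁ k i) = (b₁ k).repr x i := fun k i x => by
    rw [← hΦ₁, hfb₁def, Module.Basis.map_apply, LinearEquiv.apply_symm_apply, Module.Basis.dualBasis_apply]
  have hfb₂ : ∀ k i (x : ↥(L k)), ψC x (fb₂ k i) = (b₂ k).repr x i := fun k i x => by
    rw [← hΦ₂, hfb₂def, Module.Basis.map_apply, LinearEquiv.apply_symm_apply, Module.Basis.dualBasis_apply]
  -- the letters of colour `k`, indexed by `Fin (a k) ⊕ Fin (b k)`
  set e : ∀ k, Fin (a k) ⊕ Fin (b k) → ℂ ⊗[ℚ] V := fun k =>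
    Sum.elim (fun i => (b₁ k i : ℂ ⊗[ℚ] V)) (fun j => (b₂ k j : ℂ ⊗[ℚ] V)) with hedef
  set f : ∀ k, Fin (a k) ⊕ Fin (b k) → ℂ ⊗[ℚ] V := fun k =>
    Sum.elim (fun i => (fb₁ k i : ℂ ⊗[ℚ] V)) (fun j => (fb₂ k j : ℂ ⊗[ℚ] V)) with hfdef
  set κ₀ : ∀ k, Fin (a k) ⊕ Fin (b k) → Fin 2 := fun k => Sum.elim (fun _ => 0) (fun _ => 1) with hκ₀def
  have heW : ∀ k s, e k s ∈ Module.End.eigenspace φC (μ k) := by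
    rintro k (i | j); exacts [(b₁ k i).2.1, (b₂ k j).2.1]
  have hfW' : ∀ k s, f k s ∈ Module.End.eigenspace φC (starRingEnd ℂ (μ k)) := by
    rintro k (i | j); exacts [(fb₁ k i).2.1, (fb₂ k j).2.1]
  have he0 : ∀ k s, κ₀ k s = 0 → e k s ∈ H.piece 1 0 ∧ f k s ∈ H.piece 0 1 := by
    rintro k (i | j) h
    · exact ⟨(b₁ k i).2.2, (fb₁ k i).2.2⟩
    · simp [hκ₀def] at h
  have he1 : ∀ k s, κ₀ k s = 1 → e k s ∈ H.piece 0 1 ∧ f k s ∈ H.piece 1 0 := by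
    rintro k (i | j) h
    · simp [hκ₀def] at h
    · exact ⟨(b₂ k j).2.2, (fb₂ k j).2.2⟩
  have hdual₀ : ∀ k s s', ψC (e k s) (f k s') = if s = s' then 1 else 0 := by
    rintro k (i | i) (j | j)
    · change ψC (b₁ k i : ℂ ⊗[ℚ] V) (fb₁ k j) = _
      rw [hfb₁, Module.Basis.repr_self, Finsupp.single_apply]
      by_cases h : i = j
      · subst h; simp
      · rw [if_neg h, if_neg (fun h' => h (Sum.inl_injective h'))]
    · change ψC (b₁ k i : ℂ ⊗[ℚ] V) (fb₂ k j) = _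
      rw [h1100 _ (b₁ k i).2.2 _ (fb₂ k j).2.2, if_neg Sum.inl_ne_inr]
    · change ψC (b₂ k i : ℂ ⊗[ℚ] V) (fb₁ k j) = _
      rw [h0101 _ (b₂ k i).2.2 _ (fb₁ k j).2.2, if_neg Sum.inr_ne_inl]
    · change ψC (b₂ k i : ℂ ⊗[ℚ] V) (fb₂ k j) = _
      rw [hfb₂, Module.Basis.repr_self, Finsupp.single_apply]
      by_cases h : i = j
      · subst h; simp
      · rw [if_neg h, if_neg (fun h' => h (Sum.inr_injective h'))]
  -- all letters at once: the sigma type `Λ = Σ k, (Fin (a k) ⊕ Fin (b k))`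
  set e' : (Σ k, (Fin (a k) ⊕ Fin (b k))) → ℂ ⊗[ℚ] V := fun x => e x.1 x.2 with he'def
  set f' : (Σ k, (Fin (a k) ⊕ Fin (b k))) → ℂ ⊗[ℚ] V := fun x => f x.1 x.2 with hf'def
  have hT01 : ∀ x y : (Σ k, (Fin (a k) ⊕ Fin (b k))), ψC (e' x) (f' y) = if x = y then 1 else 0 := by
    rintro ⟨k, s⟩ ⟨k', s'⟩
    simp only [he'def, hf'def]
    by_cases hkk : k = k'
    · subst hkk
      rw [hdual₀]
      by_cases hss : s = s'
      · subst hss; rw [if_pos rfl, if_pos rfl]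
      · rw [if_neg hss, if_neg (fun h => hss (by
          rw [Sigma.mk.inj_iff] at h
          exact eq_of_heq h.2))]
    · rw [if_neg (fun h => hkk (by rw [Sigma.mk.inj_iff] at h; exact h.1))]
      refine hperp ?_ (heW _ _) (hfW' _ _)
      rw [starRingEnd_self_apply]
      exact hinj.ne hkk
  have hT00 : ∀ x y : (Σ k, (Fin (a k) ⊕ Fin (b k))), ψC (e' x) (e' y) = 0 := fun x y =>
    hperp (hdist y.1 x.1) (heW _ _) (heW _ _)
  have hT11 : ∀ x y : (Σ k, (Fin (a k) ⊕ Fin (b k))), ψC (f' x) (f' y) = 0 := fun x y => by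
    refine hperp ?_ (hfW' _ _) (hfW' _ _)
    rw [starRingEnd_self_apply]
    exact (hdist x.1 y.1).symm
  -- the combined family, indexed by `Fin 2 × Λ`
  set cbf : Fin 2 × (Σ k, (Fin (a k) ⊕ Fin (b k))) → ℂ ⊗[ℚ] V := fun x => if x.1 = 0 then e' x.2 else f' x.2
    with hcbfdef
  have hcbf0 : ∀ ℓ, cbf (0, ℓ) = e' ℓ := fun ℓ => by simp [hcbfdef]
  have hcbf1 : ∀ ℓ, cbf (1, ℓ) = f' ℓ := fun ℓ => by simp [hcbfdef]
  have hcolumn : ∀ x ℓ, ψC (cbf x) (cbf (1, ℓ)) = if x = (0, ℓ) then 1 else 0 := by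
    rintro ⟨t, i⟩ ℓ
    rcases CMTheta.fin2_cases' t with rfl | rfl
    · rw [hcbf0, hcbf1, hT01]
      by_cases h : i = ℓ
      · rw [if_pos h, if_pos (by rw [h])]
      · rw [if_neg h, if_neg (fun h' => h (by simpa [Prod.mk.injEq] using h'))]
    · rw [hcbf1, hcbf1, hT11, if_neg (fun h' => by simp [Prod.mk.injEq] at h')]
  have hrow : ∀ x ℓ, ψC (cbf (0, ℓ)) (cbf x) = if x = (1, ℓ) then 1 else 0 := by
    rintro ⟨t, i⟩ ℓ
    rcases CMTheta.fin2_cases' t with rfl | rfl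
    · rw [hcbf0, hcbf0, hT00, if_neg (fun h' => by simp [Prod.mk.injEq] at h')]
    · rw [hcbf0, hcbf1, hT01]
      by_cases h : ℓ = i
      · rw [if_pos h, if_pos (by rw [h])]
      · rw [if_neg h, if_neg (fun h' => h (by simpa [Prod.mk.injEq, eq_comm] using h'))]
  -- linear independence by the pairing table
  have hli : LinearIndependent ℂ cbf := by
    rw [Fintype.linearIndependent_iff]
    intro c hc
    rintro ⟨t, ℓ⟩
    rcases CMTheta.fin2_cases' t with rfl | rfl
    · have h := congrArg (fun z => ψC z (cbf (1, ℓ))) hc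
      simp only [map_sum, map_smul, LinearMap.sum_apply, LinearMap.smul_apply, smul_eq_mul, hcolumn,
        mul_ite, mul_one, mul_zero, Finset.sum_ite_eq', Finset.mem_univ, if_true, map_zero,
        LinearMap.zero_apply] at h
      exact h
    · have h := congrArg (fun z => ψC (cbf (0, ℓ)) z) hc
      simp only [map_sum, map_smul, smul_eq_mul, hrow, mul_ite, mul_one, mul_zero, Finset.sum_ite_eq',
        Finset.mem_univ, if_true, map_zero] at h
      exact h
  -- spanning: `V_ℂ = ⊕_k (W_{μ k} ⊕ W_{conj μ k})` (`htop`) and each `W_c` is `Θ`-graded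
  have hspan : ⊤ ≤ Submodule.span ℂ (Set.range cbf) := by
    rintro v -
    have hsub : ∀ (S : Submodule ℂ (ℂ ⊗[ℚ] V)) {ι' : Type} [Fintype ι'] (bS : Module.Basis ι' ℂ S)
        (emb : ι' → Fin 2 × (Σ k, (Fin (a k) ⊕ Fin (b k)))) (hemb : ∀ i, cbf (emb i) = bS i) (x : ℂ ⊗[ℚ] V)
        (hx : x ∈ S), x ∈ Submodule.span ℂ (Set.range cbf) := by
      intro S ι' _ bS emb hemb x hx
      have h := congrArg Subtype.val (bS.sum_repr ⟨x, hx⟩)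
      simp only [Submodule.coe_sum, Submodule.coe_smul] at h
      rw [← h]
      refine Submodule.sum_mem _ fun i _ => Submodule.smul_mem _ _ ?_
      rw [← hemb]
      exact Submodule.subset_span ⟨emb i, rfl⟩
    have hv : v ∈ ⨆ kt : ι × Fin 2, Module.End.eigenspace φC
        (if kt.2 = 0 then μ kt.1 else starRingEnd ℂ (μ kt.1)) := by
      rw [htop]; exact Submodule.mem_top
    refine Submodule.iSup_induction _ (motive := fun x => x ∈ Submodule.span ℂ (Set.range cbf)) hv
      (fun kt w hw => ?_) (Submodule.zero_mem _) (fun x y hx hy => Submodule.add_mem _ hx hy)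
    obtain ⟨k, t⟩ := kt
    have hw_eq : w = (2 : ℂ)⁻¹ • (w + Θ w) + (2 : ℂ)⁻¹ • (w - Θ w) := by module
    rcases CMTheta.fin2_cases' t with rfl | rfl
    · have hw' : w ∈ Module.End.eigenspace φC (μ k) := by simpa using hw
      have hPw : (2 : ℂ)⁻¹ • (w + Θ w) ∈ W₁ k :=
        ⟨Submodule.smul_mem _ _ (Submodule.add_mem _ hw' (hΘW _ w hw')), hP w⟩
      have hQw : (2 : ℂ)⁻¹ • (w - Θ w) ∈ L k :=
        ⟨Submodule.smul_mem _ _ (Submodule.sub_mem _ hw' (hΘW _ w hw')), hQ w⟩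
      rw [hw_eq]
      refine Submodule.add_mem _ ?_ ?_
      · exact hsub (W₁ k) (b₁ k) (fun i => (0, ⟨k, Sum.inl i⟩)) (fun i => by rw [hcbf0]; rfl) _ hPw
      · exact hsub (L k) (b₂ k) (fun j => (0, ⟨k, Sum.inr j⟩)) (fun j => by rw [hcbf0]; rfl) _ hQw
    · have hw' : w ∈ Module.End.eigenspace φC (starRingEnd ℂ (μ k)) := by simpa using hw
      have hPw : (2 : ℂ)⁻¹ • (w + Θ w) ∈ L' k :=
        ⟨Submodule.smul_mem _ _ (Submodule.add_mem _ hw' (hΘW _ w hw')), hP w⟩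
      have hQw : (2 : ℂ)⁻¹ • (w - Θ w) ∈ W₁' k :=
        ⟨Submodule.smul_mem _ _ (Submodule.sub_mem _ hw' (hΘW _ w hw')), hQ w⟩
      rw [hw_eq]
      refine Submodule.add_mem _ ?_ ?_
      · exact hsub (L' k) (fb₂ k) (fun j => (1, ⟨k, Sum.inr j⟩)) (fun j => by rw [hcbf1]; rfl) _ hPw
      · exact hsub (W₁' k) (fb₁ k) (fun i => (1, ⟨k, Sum.inl i⟩)) (fun i => by rw [hcbf1]; rfl) _ hQw
  -- the basis, letters enumerated by `Fin N`
  set cbι := Module.Basis.mk hli hspan with hcbιdef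
  set N := Fintype.card (Σ k, (Fin (a k) ⊕ Fin (b k))) with hN
  set σ : (Σ k, (Fin (a k) ⊕ Fin (b k))) ≃ Fin N := Fintype.equivFin _ with hσ
  refine ⟨N, cbι.reindex ((Equiv.refl (Fin 2)).prodCongr σ), fun ℓ => κ₀ (σ.symm ℓ).1 (σ.symm ℓ).2,
    fun ℓ => (σ.symm ℓ).1, fun ℓ => ?_, fun ℓ => ?_, fun ℓ h => ?_, fun ℓ h => ?_, fun i j => ?_, fun t i j => ?_⟩
  · rw [Module.Basis.reindex_apply, Equiv.prodCongr_symm, Equiv.prodCongr_apply, Equiv.refl_symm,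
      Equiv.coe_refl, Prod.map_apply, id, hcbιdef, Module.Basis.mk_apply, hcbf0]
    exact heW _ _
  · rw [Module.Basis.reindex_apply, Equiv.prodCongr_symm, Equiv.prodCongr_apply, Equiv.refl_symm,
      Equiv.coe_refl, Prod.map_apply, id, hcbιdef, Module.Basis.mk_apply, hcbf1]
    exact hfW' _ _
  · simp only [Module.Basis.reindex_apply, Equiv.prodCongr_symm, Equiv.prodCongr_apply, Equiv.refl_symm,
      Equiv.coe_refl, Prod.map_apply, id, hcbιdef, Module.Basis.mk_apply, hcbf0, hcbf1]
    exact he0 _ _ h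
  · simp only [Module.Basis.reindex_apply, Equiv.prodCongr_symm, Equiv.prodCongr_apply, Equiv.refl_symm,
      Equiv.coe_refl, Prod.map_apply, id, hcbιdef, Module.Basis.mk_apply, hcbf0, hcbf1]
    exact he1 _ _ h
  · simp only [Module.Basis.reindex_apply, Equiv.prodCongr_symm, Equiv.prodCongr_apply, Equiv.refl_symm,
      Equiv.coe_refl, Prod.map_apply, id, hcbιdef, Module.Basis.mk_apply, hcbf0, hcbf1, hT01,
      σ.symm.injective.eq_iff]
  · simp only [Module.Basis.reindex_apply, Equiv.prodCongr_symm, Equiv.prodCongr_apply, Equiv.refl_symm,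
      Equiv.coe_refl, Prod.map_apply, id, hcbιdef, Module.Basis.mk_apply]
    rcases CMTheta.fin2_cases' t with rfl | rfl
    · rw [hcbf0, hcbf0]; exact hT00 _ _
    · rw [hcbf1, hcbf1]; exact hT11 _ _

end CMBlockedDualBases

end HodgeStructure

end Literature.AlgebraicGeometry.Motives

end
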